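import Summits.QuantumAdvantage.QuantumAdvantage.Theorems.NearExactIsExact.Negative.TwistedTranslation

/-!
# `NearExactIsExact` (stmt-QuantumAdvantage-14043) — THEOREM C2 (gen 38), part 1/2: column pencils,
  Möbius pull-back

Column pencils over a twisted frame: `π(u,t) = (γ u, B(u) ⊕ t ⊕ t₁·v(u))`, i.e. fibre matrix
`M(u) = I + v(u) e₁ᵀ` with a FIXED functional `e₁ᵀ` and an ARBITRARY image vector `v(u) ⊥ e₁`
(`v(u)₁ = 0`, so that `M(u)` is an involution).  `colPencil_pullback` (pure algebra in `γ, B, v`):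
if `c₁(u,w) ⊕ c₂(γ u, w ⊕ w₁·v(u) ⊕ B(u)) = 1_{u=0}` for all `(u,w)`, then the `s`-Möbius
coefficients `G_T(u) = Σ_{S ⊇ T} B_{S∖T}(u)·(coefC c₂ S)(γ u)` of `s ↦ c₂(γ u, B u ⊕ s)` satisfy
(P1) `G_T = (c₁)_T` for `1 ∉ T ≠ ∅` (the points `(u, 1_J)`, `J ⊆ T`, are fixed by the involution), and
(P3) for `b, c ≠ 1`: `G_{1bc}(u) = (c₁)_{1bc}(u) + Σ_j v_j(u)·[F(u,0 ⊕ e_j) + F(u,0)]`,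
`F = dsum c₁ {b,c}` (an affine function on `𝔽₂¹¹`); the bracket is `(c₁)_{jbc}` for `j ∉ {b,c}`
and `0` for `j ∈ {b,c}` (evaluated in part 2); plus the `decide`d bookkeeping identity
`colPencil_bookkeeping` of the cubic terms used by the parity core.  DISPROOF.md §46.11 of the b2b cell.

HONEST FRAMING: the value here is a THEOREM (kernel-checked negative lemmas about one infinite
sub-family of the last Maiorana–McFarland habitat of `NearExactIsExact`), NOT summit progress; the crux
and the summit are untouched.
-/

set_option linter.dupNamespace false -- D-0017: single-problem summit ⇒ `QuantumAdvantage.QuantumAdvantage` by design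

namespace Summit.QuantumAdvantage.QuantumAdvantage.Theorems.NearExactIsExact.Negative.ColumnPencilPullback

open Finset
open Literature.Computability.QuantumComplexity
open Literature.Computability.QuantumComplexity.BuzetChailloux (bxor)
open Summit.QuantumAdvantage.QuantumAdvantage.Theorems.CubicForrelation.NearExactIsExact
  (stub_derivDegree tc_const_of_deg_zero)
open Summit.QuantumAdvantage.QuantumAdvantage.Theorems.NearExactIsExact.Negative.SkewProductCore
open Summit.QuantumAdvantage.QuantumAdvantage.Theorems.NearExactIsExact.Negative.SkewProductResidual
open Summit.QuantumAdvantage.QuantumAdvantage.Theorems.NearExactIsExact.Negative.TwistedTranslation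

/-- **Bookkeeping of the `|S| = 3` terms for the star at `1`.** A set `S` is counted
`|S ∩ {0,2,3,4}| ≡ [1 ∉ S]` times (mod 2). [folklore] -/
theorem colPencil_bookkeeping (X : Finset (Fin 5) → ZMod 2)
    (hX : ∀ S ∈ P3 5, S.card = 3 → (1 : Fin 5) ∉ S → X S = 0) :
    (∑ S ∈ (P3 5).filter (fun S => (0 : Fin 5) ∈ S ∧ S.card = 3), X S) +
      ((∑ S ∈ (P3 5).filter (fun S => (2 : Fin 5) ∈ S ∧ S.card = 3), X S) +
        ((∑ S ∈ (P3 5).filter (fun S => (3 : Fin 5) ∈ S ∧ S.card = 3), X S) +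
          (∑ S ∈ (P3 5).filter (fun S => (4 : Fin 5) ∈ S ∧ S.card = 3), X S))) = 0 := by
  have key : ∀ S ∈ P3 5, ((if (0 : Fin 5) ∈ S ∧ S.card = 3 then (1 : ZMod 2) else 0) +
      ((if (2 : Fin 5) ∈ S ∧ S.card = 3 then (1 : ZMod 2) else 0) +
        ((if (3 : Fin 5) ∈ S ∧ S.card = 3 then (1 : ZMod 2) else 0) +
          (if (4 : Fin 5) ∈ S ∧ S.card = 3 then (1 : ZMod 2) else 0)))) =
      (if S.card = 3 ∧ (1 : Fin 5) ∉ S then (1 : ZMod 2) else 0) := by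
    decide
  have hc : ∀ S ∈ P3 5, ((if (0 : Fin 5) ∈ S ∧ S.card = 3 then X S else 0) +
      ((if (2 : Fin 5) ∈ S ∧ S.card = 3 then X S else 0) +
        ((if (3 : Fin 5) ∈ S ∧ S.card = 3 then X S else 0) +
          (if (4 : Fin 5) ∈ S ∧ S.card = 3 then X S else 0)))) =
      (if S.card = 3 ∧ (1 : Fin 5) ∉ S then X S else 0) := by
    intro S hS
    have e := congrArg (· * X S) (key S hS)
    simpa only [add_mul, ite_mul, one_mul, zero_mul] using e
  simp only [sum_filter]
  rw [← sum_add_distrib, ← sum_add_distrib, ← sum_add_distrib, sum_congr rfl hc, ← sum_filter]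
  exact sum_eq_zero fun S hS => by
    rw [mem_filter] at hS
    exact hX S hS.1 hS.2.1 hS.2.2

/-- **THEOREM C2, Möbius pull-back (P1), (P3).** See the module docstring. [folklore] -/
theorem colPencil_pullback (γ : (Fin 6 → Bool) → (Fin 6 → Bool))
    (B : Fin 5 → (Fin 6 → Bool) → Bool) (v : (Fin 6 → Bool) → Fin 5 → Bool) (hv1 : ∀ u, v u 1 = false)
    (c₁ c₂ : (Fin (6 + 5) → Bool) → Bool) (h₁ : IsDegLeFun 3 c₁) (h₂ : IsDegLeFun 3 c₂)
    (h : ∀ (u : Fin 6 → Bool) (w : Fin 5 → Bool),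
      (c₁ (Fin.append u w) ^^
        c₂ (Fin.append (γ u) (fun k => (w k ^^ (w 1 && v u k)) ^^ B k u))) =
        decide (∀ i, u i = false)) :
    (∀ T : Finset (Fin 5), (1 : Fin 5) ∉ T → T.Nonempty → ∀ u,
      decide ((∑ S ∈ (P3 5).filter (fun S => T ⊆ S),
        (∏ m ∈ S \ T, ind (B m u)) * ind (coefC c₂ S (γ u))) = 1) = coefC c₁ T u) ∧
    (∀ b c : Fin 5, b ≠ 1 → c ≠ 1 → b ≠ c → ∀ u,
      (∑ S ∈ (P3 5).filter (fun S => ({1, b, c} : Finset (Fin 5)) ⊆ S),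
        (∏ m ∈ S \ {1, b, c}, ind (B m u)) * ind (coefC c₂ S (γ u))) =
        ind (coefC c₁ {1, b, c} u) + ∑ j : Fin 5, ind (v u j) *
          (ind (dsum c₁ {b, c} (bxor (emb 5 u) (dir j))) + ind (dsum c₁ {b, c} (emb 5 u)))) := by
  have z2 : (2 : ZMod 2) = 0 := rfl
  -- the involution `tw u` of the block and the pull-back `c₁' = c₁ ∘ Φ`
  obtain ⟨tw, htw⟩ : ∃ tw : (Fin 6 → Bool) → (Fin 5 → Bool) → Fin 5 → Bool,
      tw = fun u w k => (w k ^^ (w 1 && v u k)) := ⟨_, rfl⟩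
  have hinv : ∀ u w k, tw u (tw u w) k = w k := by
    intro u w k
    rw [htw]
    dsimp only
    rw [hv1 u, Bool.and_false, Bool.xor_false]
    cases w k <;> cases w 1 <;> cases v u k <;> rfl
  have htw_of : ∀ u w, w 1 = false → tw u w = w := by
    intro u w hw; funext k; rw [htw]; simp [hw]
  obtain ⟨c₁', hc₁'⟩ : ∃ c₁' : (Fin (6 + 5) → Bool) → Bool,
      c₁' = fun x => c₁ (Fin.append (uPart x) (tw (uPart x) (tPart x))) := ⟨_, rfl⟩
  have happ : ∀ u w, c₁' (Fin.append u w) = c₁ (Fin.append u (tw u w)) := by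
    intro u w
    have hu : uPart (Fin.append u w) = u := funext fun i => Fin.append_left u w i
    have ht : tPart (Fin.append u w) = w := funext fun k => Fin.append_right u w k
    rw [hc₁']
    dsimp only
    rw [hu, ht]
  -- (x) the residual equation solved for `c₂`, in the coordinates `s = tw u t`
  have hx : ∀ (u : Fin 6 → Bool) (s : Fin 5 → Bool),
      c₂ (Fin.append (γ u) (fun k => s k ^^ B k u)) =
        (c₁' (Fin.append u s) ^^ decide (∀ i, u i = false)) := by
    intro u s
    have h' := h u (tw u s)
    have e : ∀ k, (tw u s k ^^ (tw u s 1 && v u k)) = s k := by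
      intro k
      have := hinv u s k
      rw [htw] at this ⊢
      exact this
    simp only [e] at h'
    rw [happ]
    exact bool_solve _ _ _ h'
  -- the `s`-Möbius coefficients `G_T(u)` of `s ↦ c₂(γ u, B u ⊕ s)`
  obtain ⟨G, hGdef⟩ : ∃ G : Finset (Fin 5) → (Fin 6 → Bool) → ZMod 2, ∀ T u, G T u =
      ∑ S ∈ (P3 5).filter (fun S => T ⊆ S),
        (∏ m ∈ S \ T, ind (B m u)) * ind (coefC c₂ S (γ u)) := ⟨fun T u => _, fun _ _ => rfl⟩
  simp only [← hGdef]
  -- (G) `G_T(u) = Σ_{J ⊆ T} c₁'(u, 1_J)` for `T ≠ ∅`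
  have hG : ∀ T : Finset (Fin 5), T.Nonempty → ∀ u,
      G T u = ∑ J ∈ T.powerset, ind (c₁' (bxor (emb 5 u) (L J))) := by
    intro T hT u
    rw [hGdef, tTcoef_eq B (fun S u => coefC c₂ S (γ u)) T u]
    have hJ : ∀ J ∈ T.powerset, texp (fun S u => coefC c₂ S (γ u)) (fun m => decide (m ∈ J) ^^ B m u) u =
        ind (c₁' (bxor (emb 5 u) (L J))) + ind (decide (∀ i, u i = false)) := by
      intro J _
      rw [← expand_comp c₂ h₂, emb_bxor_L, ← ind_xor, ← hx u (indic J)]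
      rfl
    have h2T : ((2 ^ T.card : ℕ) : ZMod 2) = 0 := by
      rw [Nat.cast_pow, Nat.cast_ofNat, z2]
      exact zero_pow (card_pos.mpr hT).ne'
    rw [sum_congr rfl hJ, sum_add_distrib, sum_const, card_powerset, nsmul_eq_mul, h2T, zero_mul,
      add_zero]
  -- (P1) `1 ∉ T`: `Φ` fixes the points `(u, 1_J)`, `J ⊆ T`
  have hQ1 : ∀ T : Finset (Fin 5), (1 : Fin 5) ∉ T → ∀ u, ∀ J ∈ T.powerset,
      c₁' (bxor (emb 5 u) (L J)) = c₁ (bxor (emb 5 u) (L J)) := by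
    intro T h1 u J hJ
    have h1J : indic J 1 = false := decide_eq_false fun h => h1 (mem_powerset.mp hJ h)
    rw [emb_bxor_L, happ, htw_of u (indic J) h1J]
  have hQ1c : ∀ T : Finset (Fin 5), (1 : Fin 5) ∉ T → T.Nonempty → ∀ u,
      decide (G T u = 1) = coefC c₁ T u := by
    intro T h1 hT u
    rw [hG T hT u, sum_congr rfl (fun J hJ => by rw [hQ1 T h1 u J hJ])]
    rfl
  -- (P3) `T = {1, b, c}`: the points `(u, 1_{J ∪ 1})` move to `(u, 1_{J ∪ 1} ⊕ v(u))`
  have hP3 : ∀ b c : Fin 5, b ≠ 1 → c ≠ 1 → b ≠ c → ∀ u,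
      G {1, b, c} u = ind (coefC c₁ {1, b, c} u) + ∑ j : Fin 5, ind (v u j) *
        (ind (dsum c₁ {b, c} (bxor (emb 5 u) (dir j))) + ind (dsum c₁ {b, c} (emb 5 u))) := by
    intro b c hb1 hc1 hbc u
    have h1bc : (1 : Fin 5) ∉ ({b, c} : Finset (Fin 5)) := by
      simp only [mem_insert, mem_singleton, not_or]; exact ⟨fun h => hb1 h.symm, fun h => hc1 h.symm⟩
    -- the affine function `F = dsum c₁ {b,c}` and its constant increments
    obtain ⟨F, hF⟩ : ∃ F : (Fin (6 + 5) → Bool) → Bool, F = dsum c₁ {b, c} := ⟨_, rfl⟩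
    have hFsum : ∀ x, ind (F x) = ∑ J ∈ ({b, c} : Finset (Fin 5)).powerset, ind (c₁ (bxor x (L J))) := by
      intro x; rw [hF]; simp only [dsum, ind_decide_eq_one]
    have hF1 : IsDegLeFun 1 F := by
      have hd := dsum_deg c₁ h₁ ({b, c} : Finset (Fin 5))
      rw [card_pair hbc] at hd
      rw [hF]; exact hd
    have hDF : ∀ (j : Fin 5) (x y : Fin (6 + 5) → Bool),
        (F x ^^ F (bxor x (dir j))) = (F y ^^ F (bxor y (dir j))) := fun j x y =>
      tc_const_of_deg_zero (stub_derivDegree (6 + 5) 0 F (dir j) (hF1.mono (by norm_num))) x y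
    have hpeel : ∀ (K : Finset (Fin 5)) (x : Fin (6 + 5) → Bool),
        ind (F (bxor x (L K))) = ind (F x) + ∑ j ∈ K, (ind (F (bxor x (dir j))) + ind (F x)) := by
      intro K
      induction K using Finset.induction_on with
      | empty => intro x; rw [bxor_L_empty, sum_empty, add_zero]
      | insert j K hj ih =>
        intro x
        rw [L_insert hj, SignedExactCubicForrelationNotPrBPP.PolarGeometry.bxor_bxor_swap x (L K) (dir j),
          ih (bxor x (dir j)), sum_insert hj]
        have e : ∀ i, ind (F (bxor (bxor x (dir j)) (dir i))) + ind (F (bxor x (dir j))) =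
            ind (F (bxor x (dir i))) + ind (F x) := by
          intro i
          have := congrArg ind (hDF i (bxor x (dir j)) x)
          rw [ind_xor, ind_xor] at this
          linear_combination this
        rw [sum_congr rfl fun i _ => e i]
        linear_combination (-(ind (F x))) * z2
    -- the moved points
    have hpt : ∀ J : Finset (Fin 5), (1 : Fin 5) ∉ J →
        Fin.append u (tw u (indic (insert 1 J))) =
          bxor (bxor (bxor (emb 5 u) (L (supp (v u)))) (dir 1)) (L J) := by
      intro J h1J
      funext x
      induction x using Fin.addCases with
      | left i => simp [htw, bxor, emb, L, dir]
      | right k =>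
        simp only [Fin.append_right, htw, bxor, emb, L, dir, indic, supp, mem_filter, mem_univ, true_and,
          mem_insert, Bool.decide_eq_true]
        by_cases hk : k = 1
        · subst hk
          rw [hv1 u]
          simp [h1J]
        · have e1 : decide (k = 1 ∨ k ∈ J) = decide (k ∈ J) := by simp [hk]
          have e2 : decide (True ∨ (1 : Fin 5) ∈ J) = true := by simp
          rw [e1, e2, Bool.true_and, decide_eq_false hk]
          cases v u k <;> cases decide (k ∈ J) <;> rfl
    rw [hG _ ⟨1, mem_insert_self _ _⟩ u, sum_powerset_insert h1bc]
    have hA : ∀ J ∈ ({b, c} : Finset (Fin 5)).powerset,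
        ind (c₁' (bxor (emb 5 u) (L J))) = ind (c₁ (bxor (emb 5 u) (L J))) := fun J hJ => by
      rw [hQ1 {b, c} h1bc u J hJ]
    have hB' : ∀ J ∈ ({b, c} : Finset (Fin 5)).powerset, ind (c₁' (bxor (emb 5 u) (L (insert 1 J)))) =
        ind (c₁ (bxor (bxor (bxor (emb 5 u) (L (supp (v u)))) (dir 1)) (L J))) := by
      intro J hJ
      have h1J : (1 : Fin 5) ∉ J := fun h => h1bc (mem_powerset.mp hJ h)
      rw [emb_bxor_L, happ, hpt J h1J]
    rw [sum_congr rfl hA, sum_congr rfl hB', ← hFsum, ← hFsum]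
    have e1 : ind (F (bxor (bxor (emb 5 u) (L (supp (v u)))) (dir 1))) =
        ind (F (bxor (emb 5 u) (L (supp (v u))))) + (ind (F (bxor (emb 5 u) (dir 1))) + ind (F (emb 5 u))) := by
      have := congrArg ind (hDF 1 (bxor (emb 5 u) (L (supp (v u)))) (emb 5 u))
      rw [ind_xor, ind_xor] at this
      linear_combination this - (ind (F (bxor (emb 5 u) (L (supp (v u)))))) * z2
    have hcoef : ind (coefC c₁ {1, b, c} u) = ind (F (emb 5 u)) + ind (F (bxor (emb 5 u) (dir 1))) := by
      have e := congrFun (dsum_insert c₁ h1bc) (emb 5 u)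
      simp only [← hF] at e
      show ind (dsum c₁ (insert 1 {b, c}) (emb 5 u)) = _
      rw [e, ind_xor]
    have hsupp : ∑ j ∈ supp (v u), (ind (F (bxor (emb 5 u) (dir j))) + ind (F (emb 5 u))) =
        ∑ j : Fin 5, ind (v u j) * (ind (F (bxor (emb 5 u) (dir j))) + ind (F (emb 5 u))) := by
      rw [supp, sum_filter]
      refine sum_congr rfl fun j _ => ?_
      cases v u j <;> simp
    rw [e1, hpeel (supp (v u)) (emb 5 u), hcoef]
    rw [hF] at hsupp ⊢
    rw [← hsupp]
    linear_combination (ind (dsum c₁ {b, c} (emb 5 u))) * z2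
  refine ⟨hQ1c, fun b c hb1 hc1 hbc u => ?_⟩
  exact hP3 b c hb1 hc1 hbc u

end Summit.QuantumAdvantage.QuantumAdvantage.Theorems.NearExactIsExact.Negative.ColumnPencilPullback
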